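import Summits.AnomalousDissipation.AnomalousDissipation.Theorems.SawtoothPulseCascadeK1LocalisedCascadeKHBlochPoly
import Summits.AnomalousDissipation.AnomalousDissipation.Theorems.SawtoothPulseCascadeK1LocalisedCascadeKHTransportCoeff

/-!
# K2 lane (route-2 `SawtoothPulseCascade`, crux dir `K1LocalisedCascade`): the FREEZING BOUND for one sawtooth transport slot — a row profile's windowed coefficients move by at most `π|a||θ|/2 · ‖profile‖` (P2-D, the age law for debris, A28-3 (5) / A28-5)

Helper file of the K2 lane (ACL item stmt-AnomalousDissipation-19491).  In p4's `hTransport`/`vTransport` (crux copies of `K2ConeSketch`) one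
row (resp. column) profile `P(y) = Σ_{n∈S} z(n) e^{2πi(β+n)y}` of a lattice state on the line of streamwise wavenumber `a` is multiplied by the
unimodular transport phase `u(y) = e^{−2πiaθ·tri(y)}` of a sawtooth shear of strain `θ` and re-expanded.  Since `|tri| ≤ 1/4`, `‖u − 1‖ ≤ 2π|a||θ|/4`
pointwise, so Bessel/Parseval for the continuous function `P·(u−1)` gives THE FREEZING BOUND (`transport_freezing`): for every output window `S′`,
`Σ_{n′∈S′} ‖⟨P·u, e_{n′}⟩ − z(n′)[n′ ∈ S]‖² ≤ (π|a||θ|/2)² · Σ_{n∈S} ‖z(n)‖²` — one slot changes the coefficients of a row by at most (phase depth) ×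
(the row's `ℓ²` size).  Against the row's energy weights `1/(a² + (β+n′)²) ≤ 1/a²` the factor `a²` cancels (`transport_freezing_energy`):
`Σ_{n′∈S′} ‖…‖²/(a²+(β+n′)²) ≤ (π|θ|/2)² · Σ_{n∈S} ‖z(n)‖²`, uniformly in the line `a` (for `a = 0` the left side vanishes).  In level-`ℓ` units this is
«energy moved by one slot ≤ (displacement amplitude `θ/4·2^{−ℓ}`)² × enstrophy», the summable-in-the-level increment behind the debris AGE LAW of the crux
workfile `K2DebrisAgeLaw.lean`.  Also: the enstrophy (plain `ℓ²`) Bessel bound for the transported row on any output window (`transport_bessel`) and two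
weighted-`ℓ²` inequalities used by the age-law bookkeeping (Minkowski for weighted finite sums of squares; `min ≤` the `(1/4, 3/4)` geometric mean).
No definitions; nothing about the crux by name. [folklore] [problem: turb]
-/

-- `Summit.<Summit>.<Problem>`: single-conjunct summit, the duplicate namespace segment is deliberate.
set_option linter.dupNamespace false

noncomputable section

namespace Summit.AnomalousDissipation.AnomalousDissipation.Theorems.SawtoothPulseCascade.K2PhaseBudget

open Finset MeasureTheory intervalIntegral Set Literature.Analysis.FluidPDE.SawtoothCascade

/-- **Phase depth of one slot:** `‖e^{−2πiaθ·tri(y)} − 1‖ ≤ π|a||θ|/2` (`|tri| ≤ 1/4`, `‖e^{ix} − 1‖ ≤ |x|`). [folklore] -/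
theorem norm_transportPhase_sub_one_le (a θ y : ℝ) :
    ‖Complex.exp (-((2 * Real.pi * a * θ * triWave y : ℝ) : ℂ) * Complex.I) - 1‖ ≤ Real.pi * |a| * |θ| / 2 := by
  have h1 : ‖Complex.exp (Complex.I * ((-(2 * Real.pi * a * θ * triWave y) : ℝ) : ℂ)) - 1‖ ≤ ‖(-(2 * Real.pi * a * θ * triWave y) : ℝ)‖ :=
    Real.norm_exp_I_mul_ofReal_sub_one_le
  have e : Complex.exp (-((2 * Real.pi * a * θ * triWave y : ℝ) : ℂ) * Complex.I) =
      Complex.exp (Complex.I * ((-(2 * Real.pi * a * θ * triWave y) : ℝ) : ℂ)) := by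
    congr 1; push_cast; ring
  rw [e]
  refine h1.trans ?_
  rw [Real.norm_eq_abs, abs_neg, abs_mul, abs_mul, abs_mul, abs_mul, abs_of_pos Real.pi_pos, abs_of_pos (by norm_num : (0 : ℝ) < 2)]
  have ht : |triWave y| ≤ 1 / 4 := abs_triWave_le y
  have h0 : 0 ≤ 2 * Real.pi * |a| * |θ| := by positivity
  calc 2 * Real.pi * |a| * |θ| * |triWave y| ≤ 2 * Real.pi * |a| * |θ| * (1 / 4) := mul_le_mul_of_nonneg_left ht h0
    _ = Real.pi * |a| * |θ| / 2 := by ring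

/-- **Bessel for the transported row on any output window** (the unimodular phase does not change the `L²` size of the profile):
`Σ_{n′∈S′} ‖⟨P·u, e_{n′}⟩‖² ≤ Σ_{n∈S} ‖z(n)‖²`. [folklore] -/
theorem transport_bessel (a θ β : ℝ) (S S' : Finset ℤ) (z : ℤ → ℂ) :
    ∑ n' ∈ S', ‖∫ y in (-(1 / 2 : ℝ))..(1 / 2), ((∑ n ∈ S, z n * Complex.exp ((2 * Real.pi * (β + n) * y : ℝ) * Complex.I)) *
        Complex.exp (-((2 * Real.pi * a * θ * triWave y : ℝ) : ℂ) * Complex.I)) * Complex.exp (-(2 * Real.pi * (β + n') * y : ℝ) * Complex.I)‖ ^ 2 ≤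
      ∑ n ∈ S, ‖z n‖ ^ 2 := by
  set g : ℝ → ℂ := fun y => (∑ n ∈ S, z n * Complex.exp ((2 * Real.pi * (β + n) * y : ℝ) * Complex.I)) *
    Complex.exp (-((2 * Real.pi * a * θ * triWave y : ℝ) : ℂ) * Complex.I) with hg
  have hgc : Continuous g := by
    rw [hg]
    have := continuous_triWave'
    fun_prop
  refine (sum_le_hasSum S' (fun n' _ => by positivity) (hasSum_sq_coeff hgc β)).trans (le_of_eq ?_)
  have e : ∀ y : ℝ, ‖g y‖ ^ 2 = ‖∑ n ∈ S, z n * Complex.exp ((2 * Real.pi * (β + n) * y : ℝ) * Complex.I)‖ ^ 2 := by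
    intro y
    rw [hg]
    simp only
    rw [norm_mul, show -((2 * Real.pi * a * θ * triWave y : ℝ) : ℂ) * Complex.I =
      ((-(2 * Real.pi * a * θ * triWave y) : ℝ) : ℂ) * Complex.I by push_cast; ring, Complex.norm_exp_ofReal_mul_I, mul_one]
  simp_rw [e]
  exact integral_norm_sq_blochPoly β S z

/-- **THE FREEZING BOUND.**  One transport slot moves the windowed coefficients of a row profile `P = Σ_{n∈S} z(n)e^{2πi(β+n)y}` on the line `a` by at
most the phase depth times the profile's `ℓ²` size: `Σ_{n′∈S′} ‖⟨P·e^{−2πiaθ·tri}, e_{n′}⟩ − z(n′)[n′∈S]‖² ≤ (π|a||θ|/2)²·Σ_{n∈S}‖z(n)‖²`. [folklore] -/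
theorem transport_freezing (a θ β : ℝ) (S S' : Finset ℤ) (z : ℤ → ℂ) :
    ∑ n' ∈ S', ‖(∫ y in (-(1 / 2 : ℝ))..(1 / 2), ((∑ n ∈ S, z n * Complex.exp ((2 * Real.pi * (β + n) * y : ℝ) * Complex.I)) *
        Complex.exp (-((2 * Real.pi * a * θ * triWave y : ℝ) : ℂ) * Complex.I)) * Complex.exp (-(2 * Real.pi * (β + n') * y : ℝ) * Complex.I)) -
        (if n' ∈ S then z n' else 0)‖ ^ 2 ≤
      (Real.pi * |a| * |θ| / 2) ^ 2 * ∑ n ∈ S, ‖z n‖ ^ 2 := by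
  set P : ℝ → ℂ := fun y => ∑ n ∈ S, z n * Complex.exp ((2 * Real.pi * (β + n) * y : ℝ) * Complex.I) with hP
  set u : ℝ → ℂ := fun y => Complex.exp (-((2 * Real.pi * a * θ * triWave y : ℝ) : ℂ) * Complex.I) with hu
  set g : ℝ → ℂ := fun y => P y * (u y - 1) with hg
  have hPc : Continuous P := by rw [hP]; exact continuous_blochPoly β S z
  have huc : Continuous u := by
    rw [hu]
    have := continuous_triWave'
    fun_prop
  have hgc : Continuous g := by rw [hg]; exact hPc.mul (huc.sub continuous_const)
  -- the difference is the coefficient of `P·(u − 1)`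
  have hdiff : ∀ n' : ℤ, (∫ y in (-(1 / 2 : ℝ))..(1 / 2), (P y * u y) * Complex.exp (-(2 * Real.pi * (β + n') * y : ℝ) * Complex.I)) -
      (if n' ∈ S then z n' else 0) = ∫ y in (-(1 / 2 : ℝ))..(1 / 2), g y * Complex.exp (-(2 * Real.pi * (β + n') * y : ℝ) * Complex.I) := by
    intro n'
    have h1 : (if n' ∈ S then z n' else 0) =
        ∫ y in (-(1 / 2 : ℝ))..(1 / 2), P y * Complex.exp (-(2 * Real.pi * (β + n') * y : ℝ) * Complex.I) := by
      rw [hP]; exact (integral_blochPoly_mul_conjExp β S z n').symm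
    have hi1 : IntervalIntegrable (fun y : ℝ => P y * u y * Complex.exp (-(2 * Real.pi * (β + n') * y : ℝ) * Complex.I)) volume (-(1 / 2 : ℝ)) (1 / 2) :=
      ((hPc.mul huc).mul (by fun_prop)).intervalIntegrable _ _
    have hi2 : IntervalIntegrable (fun y : ℝ => P y * Complex.exp (-(2 * Real.pi * (β + n') * y : ℝ) * Complex.I)) volume (-(1 / 2 : ℝ)) (1 / 2) :=
      (hPc.mul (by fun_prop)).intervalIntegrable _ _
    rw [h1, ← intervalIntegral.integral_sub hi1 hi2]
    refine intervalIntegral.integral_congr fun y _ => ?_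
    show P y * u y * _ - P y * _ = (P y * (u y - 1)) * _
    ring
  rw [Finset.sum_congr rfl fun n' _ => by rw [hdiff n']]
  refine (sum_le_hasSum S' (fun n' _ => by positivity) (hasSum_sq_coeff hgc β)).trans ?_
  -- `∫‖g‖² ≤ (π|a||θ|/2)² ∫‖P‖² = (π|a||θ|/2)² Σ‖z‖²`
  have hpt : ∀ y : ℝ, ‖g y‖ ^ 2 ≤ (Real.pi * |a| * |θ| / 2) ^ 2 * ‖P y‖ ^ 2 := by
    intro y
    show ‖P y * (u y - 1)‖ ^ 2 ≤ _
    rw [norm_mul, mul_pow, mul_comm]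
    refine mul_le_mul_of_nonneg_right ?_ (sq_nonneg _)
    exact pow_le_pow_left₀ (norm_nonneg _) (norm_transportPhase_sub_one_le a θ y) 2
  calc ∫ y in (-(1 / 2 : ℝ))..(1 / 2), ‖g y‖ ^ 2 ≤ ∫ y in (-(1 / 2 : ℝ))..(1 / 2), (Real.pi * |a| * |θ| / 2) ^ 2 * ‖P y‖ ^ 2 := by
        refine intervalIntegral.integral_mono_on (by norm_num) ?_ ?_ fun y _ => hpt y
        · exact (by fun_prop : Continuous fun y => ‖g y‖ ^ 2).intervalIntegrable _ _
        · exact (by fun_prop : Continuous fun y => (Real.pi * |a| * |θ| / 2) ^ 2 * ‖P y‖ ^ 2).intervalIntegrable _ _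
    _ = (Real.pi * |a| * |θ| / 2) ^ 2 * ∑ n ∈ S, ‖z n‖ ^ 2 := by
        rw [intervalIntegral.integral_const_mul, hP]
        simp only
        rw [integral_norm_sq_blochPoly β S z]

/-- **The freezing bound in ENERGY form, uniform in the line.**  Against the row's energy weights `1/(a² + (β+n′)²)` the factor `a²` of the phase depth
cancels: `Σ_{n′∈S′} ‖⟨P·u, e_{n′}⟩ − z(n′)[n′∈S]‖²/(a² + (β+n′)²) ≤ (π|θ|/2)²·Σ_{n∈S}‖z(n)‖²` for EVERY `a` (zero left side at `a = 0`).  In p4's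
level-`ℓ` energy units this reads «one slot moves the energy of a row by at most `(θ/4·2^{−ℓ})²` × its enstrophy». [folklore] -/
theorem transport_freezing_energy (a θ β : ℝ) (S S' : Finset ℤ) (z : ℤ → ℂ) :
    ∑ n' ∈ S', ‖(∫ y in (-(1 / 2 : ℝ))..(1 / 2), ((∑ n ∈ S, z n * Complex.exp ((2 * Real.pi * (β + n) * y : ℝ) * Complex.I)) *
        Complex.exp (-((2 * Real.pi * a * θ * triWave y : ℝ) : ℂ) * Complex.I)) * Complex.exp (-(2 * Real.pi * (β + n') * y : ℝ) * Complex.I)) -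
        (if n' ∈ S then z n' else 0)‖ ^ 2 / (a ^ 2 + (β + n') ^ 2) ≤
      (Real.pi * |θ| / 2) ^ 2 * ∑ n ∈ S, ‖z n‖ ^ 2 := by
  rcases eq_or_ne a 0 with ha | ha
  · -- `a = 0`: the phase is `1`, every difference vanishes
    have h0 : ∀ n' ∈ S', ‖(∫ y in (-(1 / 2 : ℝ))..(1 / 2), ((∑ n ∈ S, z n * Complex.exp ((2 * Real.pi * (β + n) * y : ℝ) * Complex.I)) *
        Complex.exp (-((2 * Real.pi * a * θ * triWave y : ℝ) : ℂ) * Complex.I)) * Complex.exp (-(2 * Real.pi * (β + n') * y : ℝ) * Complex.I)) -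
        (if n' ∈ S then z n' else 0)‖ ^ 2 / (a ^ 2 + (β + n') ^ 2) = 0 := by
      intro n' _
      have h1 : ∀ y : ℝ, Complex.exp (-((2 * Real.pi * a * θ * triWave y : ℝ) : ℂ) * Complex.I) = 1 := by
        intro y; rw [ha]; simp
      simp_rw [h1, mul_one]
      rw [integral_blochPoly_mul_conjExp, sub_self, norm_zero]
      simp
    rw [Finset.sum_congr rfl h0, Finset.sum_const_zero]
    exact mul_nonneg (sq_nonneg _) (Finset.sum_nonneg fun _ _ => by positivity)
  · have ha2 : 0 < a ^ 2 := by positivity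
    have hw : ∀ n' : ℤ, ∀ v : ℂ, ‖v‖ ^ 2 / (a ^ 2 + (β + n') ^ 2) ≤ (1 / a ^ 2) * ‖v‖ ^ 2 := by
      intro n' v
      rw [div_eq_mul_one_div, mul_comm]
      refine mul_le_mul_of_nonneg_right (div_le_div_of_nonneg_left zero_le_one ha2 ?_) (sq_nonneg _)
      nlinarith [sq_nonneg (β + n')]
    refine (Finset.sum_le_sum fun n' _ => hw n' _).trans ?_
    rw [← Finset.mul_sum]
    refine (mul_le_mul_of_nonneg_left (transport_freezing a θ β S S' z) (by positivity)).trans (le_of_eq ?_)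
    have : (Real.pi * |a| * |θ| / 2) ^ 2 = a ^ 2 * (Real.pi * |θ| / 2) ^ 2 := by rw [← sq_abs a]; ring
    rw [this]
    field_simp

/-! ## Two weighted-`ℓ²` inequalities for the age-law bookkeeping -/

/-- **Minkowski for weighted finite sums of squares:** `√(Σ w‖x+y‖²) ≤ √(Σ w‖x‖²) + √(Σ w‖y‖²)` for nonnegative weights. [folklore] -/
theorem sqrt_sum_mul_norm_add_sq_le {ι : Type*} (T : Finset ι) (w : ι → ℝ) (hw : ∀ i ∈ T, 0 ≤ w i) (x y : ι → ℂ) :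
    Real.sqrt (∑ i ∈ T, w i * ‖x i + y i‖ ^ 2) ≤ Real.sqrt (∑ i ∈ T, w i * ‖x i‖ ^ 2) + Real.sqrt (∑ i ∈ T, w i * ‖y i‖ ^ 2) := by
  set A := ∑ i ∈ T, w i * ‖x i‖ ^ 2 with hA
  set B := ∑ i ∈ T, w i * ‖y i‖ ^ 2 with hB
  have hA0 : 0 ≤ A := Finset.sum_nonneg fun i hi => mul_nonneg (hw i hi) (sq_nonneg _)
  have hB0 : 0 ≤ B := Finset.sum_nonneg fun i hi => mul_nonneg (hw i hi) (sq_nonneg _)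
  -- `Σ w‖x+y‖² ≤ (√A + √B)² = A + B + 2√A√B`
  have hcs : (∑ i ∈ T, (Real.sqrt (w i) * ‖x i‖) * (Real.sqrt (w i) * ‖y i‖)) ^ 2 ≤
      (∑ i ∈ T, (Real.sqrt (w i) * ‖x i‖) ^ 2) * (∑ i ∈ T, (Real.sqrt (w i) * ‖y i‖) ^ 2) :=
    Finset.sum_mul_sq_le_sq_mul_sq T _ _
  have eA : ∑ i ∈ T, (Real.sqrt (w i) * ‖x i‖) ^ 2 = A := by
    rw [hA]; exact Finset.sum_congr rfl fun i hi => by rw [mul_pow, Real.sq_sqrt (hw i hi)]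
  have eB : ∑ i ∈ T, (Real.sqrt (w i) * ‖y i‖) ^ 2 = B := by
    rw [hB]; exact Finset.sum_congr rfl fun i hi => by rw [mul_pow, Real.sq_sqrt (hw i hi)]
  rw [eA, eB] at hcs
  have hM0 : 0 ≤ ∑ i ∈ T, (Real.sqrt (w i) * ‖x i‖) * (Real.sqrt (w i) * ‖y i‖) :=
    Finset.sum_nonneg fun i hi => by have := hw i hi; positivity
  have hmid : ∑ i ∈ T, (Real.sqrt (w i) * ‖x i‖) * (Real.sqrt (w i) * ‖y i‖) ≤ Real.sqrt A * Real.sqrt B := by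
    rw [← Real.sqrt_mul hA0, ← Real.sqrt_sq hM0]
    exact Real.sqrt_le_sqrt hcs
  have hpt : ∀ i ∈ T, w i * ‖x i + y i‖ ^ 2 ≤ w i * ‖x i‖ ^ 2 + w i * ‖y i‖ ^ 2 + 2 * ((Real.sqrt (w i) * ‖x i‖) * (Real.sqrt (w i) * ‖y i‖)) := by
    intro i hi
    have e : (Real.sqrt (w i) * ‖x i‖) * (Real.sqrt (w i) * ‖y i‖) = w i * (‖x i‖ * ‖y i‖) := by
      rw [mul_mul_mul_comm, ← sq, Real.sq_sqrt (hw i hi)]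
    rw [e]
    have h1 : ‖x i + y i‖ ^ 2 ≤ (‖x i‖ + ‖y i‖) ^ 2 := pow_le_pow_left₀ (norm_nonneg _) (norm_add_le _ _) 2
    nlinarith [hw i hi]
  have hS : ∑ i ∈ T, w i * ‖x i + y i‖ ^ 2 ≤ (Real.sqrt A + Real.sqrt B) ^ 2 :=
    calc ∑ i ∈ T, w i * ‖x i + y i‖ ^ 2 ≤ ∑ i ∈ T, (w i * ‖x i‖ ^ 2 + w i * ‖y i‖ ^ 2 + 2 * ((Real.sqrt (w i) * ‖x i‖) * (Real.sqrt (w i) * ‖y i‖))) :=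
          Finset.sum_le_sum hpt
      _ = A + B + 2 * ∑ i ∈ T, (Real.sqrt (w i) * ‖x i‖) * (Real.sqrt (w i) * ‖y i‖) := by
          rw [Finset.sum_add_distrib, Finset.sum_add_distrib, ← Finset.mul_sum, hA, hB]
      _ ≤ A + B + 2 * (Real.sqrt A * Real.sqrt B) := by linarith
      _ = (Real.sqrt A + Real.sqrt B) ^ 2 := by
          rw [add_sq, Real.sq_sqrt hA0, Real.sq_sqrt hB0]; ring
  calc Real.sqrt (∑ i ∈ T, w i * ‖x i + y i‖ ^ 2) ≤ Real.sqrt ((Real.sqrt A + Real.sqrt B) ^ 2) := Real.sqrt_le_sqrt hS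
    _ = Real.sqrt A + Real.sqrt B := Real.sqrt_sq (by positivity)

/-- `min x y ≤ x^{1/4}·y^{3/4}` for `x, y ≥ 0`, written with square roots: `x^{1/4} = √√x`, `y^{3/4} = √(y√y)`. [folklore] -/
theorem min_le_sqrt_sqrt_mul (x y : ℝ) (hx : 0 ≤ x) (hy : 0 ≤ y) :
    min x y ≤ Real.sqrt (Real.sqrt x) * Real.sqrt (y * Real.sqrt y) := by
  -- `t ↦ √√t` and `t ↦ √(t√t)` are monotone and `√√t · √(t√t) = t`
  have key : ∀ t : ℝ, 0 ≤ t → Real.sqrt (Real.sqrt t) * Real.sqrt (t * Real.sqrt t) = t := by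
    intro t ht
    rw [← Real.sqrt_mul (Real.sqrt_nonneg t), show Real.sqrt t * (t * Real.sqrt t) = t * t by
      rw [mul_left_comm, Real.mul_self_sqrt ht], Real.sqrt_mul_self ht]
  rcases le_total x y with h | h
  · rw [min_eq_left h]
    calc x = Real.sqrt (Real.sqrt x) * Real.sqrt (x * Real.sqrt x) := (key x hx).symm
      _ ≤ Real.sqrt (Real.sqrt x) * Real.sqrt (y * Real.sqrt y) := by
          refine mul_le_mul_of_nonneg_left (Real.sqrt_le_sqrt ?_) (Real.sqrt_nonneg _)
          exact mul_le_mul h (Real.sqrt_le_sqrt h) (Real.sqrt_nonneg _) hy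
  · rw [min_eq_right h]
    calc y = Real.sqrt (Real.sqrt y) * Real.sqrt (y * Real.sqrt y) := (key y hy).symm
      _ ≤ Real.sqrt (Real.sqrt x) * Real.sqrt (y * Real.sqrt y) :=
          mul_le_mul_of_nonneg_right (Real.sqrt_le_sqrt (Real.sqrt_le_sqrt h)) (Real.sqrt_nonneg _)

/-- **Hölder `(4, 4/3)` with square roots:** `Σ_i √√(a i) · √(b i · √(b i)) ≤ √√(Σ a) · √((Σ b)·√(Σ b))` for nonnegative families
(Cauchy–Schwarz twice: `Σ a^{1/4}b^{3/4} = Σ (a^{1/4}b^{1/4})·b^{1/2} ≤ √(Σ√a√b)·√(Σ b) ≤ (Σa)^{1/4}(Σb)^{3/4}`). [folklore] -/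
theorem sum_sqrt_sqrt_mul_le {ι : Type*} (T : Finset ι) (a b : ι → ℝ) (ha : ∀ i ∈ T, 0 ≤ a i) (hb : ∀ i ∈ T, 0 ≤ b i) :
    ∑ i ∈ T, Real.sqrt (Real.sqrt (a i)) * Real.sqrt (b i * Real.sqrt (b i)) ≤
      Real.sqrt (Real.sqrt (∑ i ∈ T, a i)) * Real.sqrt ((∑ i ∈ T, b i) * Real.sqrt (∑ i ∈ T, b i)) := by
  have hA : 0 ≤ ∑ i ∈ T, a i := Finset.sum_nonneg ha
  have hB : 0 ≤ ∑ i ∈ T, b i := Finset.sum_nonneg hb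
  -- rewrite each summand as `(√√a · √√b) · √b`
  have e1 : ∀ i ∈ T, Real.sqrt (Real.sqrt (a i)) * Real.sqrt (b i * Real.sqrt (b i)) =
      (Real.sqrt (Real.sqrt (a i)) * Real.sqrt (Real.sqrt (b i))) * Real.sqrt (b i) := by
    intro i hi
    rw [Real.sqrt_mul (hb i hi), mul_assoc, mul_comm (Real.sqrt (b i))]
  rw [Finset.sum_congr rfl e1]
  -- first Cauchy–Schwarz
  have cs1 : (∑ i ∈ T, (Real.sqrt (Real.sqrt (a i)) * Real.sqrt (Real.sqrt (b i))) * Real.sqrt (b i)) ^ 2 ≤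
      (∑ i ∈ T, (Real.sqrt (Real.sqrt (a i)) * Real.sqrt (Real.sqrt (b i))) ^ 2) * (∑ i ∈ T, Real.sqrt (b i) ^ 2) :=
    Finset.sum_mul_sq_le_sq_mul_sq T _ _
  have e2 : ∑ i ∈ T, (Real.sqrt (Real.sqrt (a i)) * Real.sqrt (Real.sqrt (b i))) ^ 2 = ∑ i ∈ T, Real.sqrt (a i) * Real.sqrt (b i) :=
    Finset.sum_congr rfl fun i hi => by rw [mul_pow, Real.sq_sqrt (Real.sqrt_nonneg _), Real.sq_sqrt (Real.sqrt_nonneg _)]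
  have e3 : ∑ i ∈ T, Real.sqrt (b i) ^ 2 = ∑ i ∈ T, b i := Finset.sum_congr rfl fun i hi => Real.sq_sqrt (hb i hi)
  rw [e2, e3] at cs1
  -- second Cauchy–Schwarz: `Σ √a√b ≤ √(Σa)√(Σb)`
  have cs2 : (∑ i ∈ T, Real.sqrt (a i) * Real.sqrt (b i)) ^ 2 ≤ (∑ i ∈ T, Real.sqrt (a i) ^ 2) * (∑ i ∈ T, Real.sqrt (b i) ^ 2) :=
    Finset.sum_mul_sq_le_sq_mul_sq T _ _
  have e4 : ∑ i ∈ T, Real.sqrt (a i) ^ 2 = ∑ i ∈ T, a i := Finset.sum_congr rfl fun i hi => Real.sq_sqrt (ha i hi)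
  rw [e4, e3] at cs2
  have hS0 : 0 ≤ ∑ i ∈ T, Real.sqrt (a i) * Real.sqrt (b i) := Finset.sum_nonneg fun i _ => by positivity
  have cs2' : ∑ i ∈ T, Real.sqrt (a i) * Real.sqrt (b i) ≤ Real.sqrt (∑ i ∈ T, a i) * Real.sqrt (∑ i ∈ T, b i) := by
    rw [← Real.sqrt_mul hA, ← Real.sqrt_sq hS0]
    exact Real.sqrt_le_sqrt cs2
  have hL0 : 0 ≤ ∑ i ∈ T, (Real.sqrt (Real.sqrt (a i)) * Real.sqrt (Real.sqrt (b i))) * Real.sqrt (b i) :=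
    Finset.sum_nonneg fun i _ => by positivity
  -- combine
  have h3 : (∑ i ∈ T, (Real.sqrt (Real.sqrt (a i)) * Real.sqrt (Real.sqrt (b i))) * Real.sqrt (b i)) ^ 2 ≤
      (Real.sqrt (∑ i ∈ T, a i) * Real.sqrt (∑ i ∈ T, b i)) * (∑ i ∈ T, b i) :=
    cs1.trans (mul_le_mul_of_nonneg_right cs2' hB)
  have h4 : (Real.sqrt (Real.sqrt (∑ i ∈ T, a i)) * Real.sqrt ((∑ i ∈ T, b i) * Real.sqrt (∑ i ∈ T, b i))) ^ 2 =
      (Real.sqrt (∑ i ∈ T, a i) * Real.sqrt (∑ i ∈ T, b i)) * (∑ i ∈ T, b i) := by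
    rw [mul_pow, Real.sq_sqrt (Real.sqrt_nonneg _), Real.sq_sqrt (by positivity)]
    ring
  rw [← h4] at h3
  have hR0 : 0 ≤ Real.sqrt (Real.sqrt (∑ i ∈ T, a i)) * Real.sqrt ((∑ i ∈ T, b i) * Real.sqrt (∑ i ∈ T, b i)) := by positivity
  calc ∑ i ∈ T, (Real.sqrt (Real.sqrt (a i)) * Real.sqrt (Real.sqrt (b i))) * Real.sqrt (b i)
      = Real.sqrt ((∑ i ∈ T, (Real.sqrt (Real.sqrt (a i)) * Real.sqrt (Real.sqrt (b i))) * Real.sqrt (b i)) ^ 2) := (Real.sqrt_sq hL0).symm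
    _ ≤ Real.sqrt ((Real.sqrt (Real.sqrt (∑ i ∈ T, a i)) * Real.sqrt ((∑ i ∈ T, b i) * Real.sqrt (∑ i ∈ T, b i))) ^ 2) := Real.sqrt_le_sqrt h3
    _ = _ := Real.sqrt_sq hR0

end Summit.AnomalousDissipation.AnomalousDissipation.Theorems.SawtoothPulseCascade.K2PhaseBudget

end
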